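import Summits.QuantumFields.YangMills.Theorems.ColdStartUniversalityLatticeLangevinLiebRobinsonField
import HarnessLib

/-!
# Route `ColdStartUniversality` (fixed-cut-off SZZ dynamics; LIEB–ROBINSON / LOCALITY package, file 2):
# the plaquette-neighbour count on `(ℤ/L)³` and the WEIGHTED `ℓ¹`-Lipschitz estimate for the Doss–Sussmann field

Helper file (seat `ym-line-csu-p1`, g30; `--supports stmt-QuantumFields-24809`).  Sequel of `…LiebRobinsonField` (per-link locality of
the Doss–Sussmann field `F(p, M)_e = (p_e)ᴴ · D_β(pM)_e · p_e M_e`, explicit constants):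
* ★ `sum_plaquetteNeighbours_eq` — on `(ℤ/L)³` every link is a non-root link of EXACTLY 12 rooted plaquettes (a translation count:
  `Σ_e Σ_{j ≠ e.2} Σ_f g(f) = 12 Σ_f g(f)`);
* ★★ `weighted_dossSussmannField_lipschitz` — for every weight `w ≥ 0` with `w_e ≤ K·w_f` whenever `f` is one of the non-root links of a
  plaquette through `e`:  `Σ_e w_e ‖F(p,M)_e − F(p,M')_e‖_F ≤ |β|(4 + 4√2 + 12K) Σ_e w_e ‖M_e − M'_e‖_F` (`SU(2)`, `d = 3`, unitary
  frame `p`, unitary-valued `M, M'`).  With `w ≡ 1`, `K = 1`: a global `ℓ¹`-Frobenius Lipschitz bound with constant `|β|(16 + 4√2)`;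
  with `w_e = K^{dist(e,e₀)}`: the input of the weighted Grönwall argument giving the pathwise Lieb–Robinson bound (next file).
THEOREMS ONLY, no definition, no sorry; all [folklore].  HONEST FRAMING: fixed-cut-off algebra at ANY coupling; the constant grows
like `|β|`, so nothing here is uniform along the route's scaling `β'_K → ∞`; no crux, rung or summit statement is proved; the
Yang–Mills mass gap is NOT proved.
-/

set_option autoImplicit false

noncomputable section

namespace Summit.QuantumFields.YangMills.Theorems.ColdStartUniversality.LiebRobinson

open Matrix Finset
open scoped BigOperators Matrix ComplexConjugate
open Literature.MathematicalPhysics.QuantumFieldTheory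
open Literature.MathematicalPhysics.QuantumLattice (fundamentalLatticeRep)

/-! ## §4. `(ℤ/L)³`: every link is a non-root link of exactly 12 rooted plaquettes; the weighted estimate -/

section Torus

variable {L : ℕ} [NeZero L]

/-- Translating the base point is a bijection of the links in a fixed direction: `Σ_x g(x + c, ν) = Σ_x g(x, ν)`. [folklore] -/
theorem sum_site_translate {d : ℕ} (g : Edge d L → ℝ) (c : Literature.MathematicalPhysics.QuantumFieldTheory.Site d L)
    (ν : Fin d) :
    ∑ x : Literature.MathematicalPhysics.QuantumFieldTheory.Site d L, g (x + c, ν) =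
      ∑ x : Literature.MathematicalPhysics.QuantumFieldTheory.Site d L, g (x, ν) :=
  Fintype.sum_equiv (Equiv.addRight c) (fun x => g (x + c, ν)) (fun x => g (x, ν)) fun _ => rfl

/-- For each root direction `μ` and transverse direction `j`, the six non-root links of the two plaquettes `(x, μ; j, b)` sweep, as
the base point `x` runs over the torus, four times over the links of direction `j` and twice over those of direction `μ`.
[folklore] -/
theorem sum_site_plaquetteNeighbours (g : Edge 3 L → ℝ) (μ j : Fin 3) :
    ∑ x : Literature.MathematicalPhysics.QuantumFieldTheory.Site 3 L,
        ((g (x.shift μ, j) + g (x.shift j, μ) + g (x, j)) +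
          (g ((x - Pi.single j 1).shift μ, j) + g (x - Pi.single j 1, μ) + g (x - Pi.single j 1, j))) =
      4 * ∑ x : Literature.MathematicalPhysics.QuantumFieldTheory.Site 3 L, g (x, j) +
        2 * ∑ x : Literature.MathematicalPhysics.QuantumFieldTheory.Site 3 L, g (x, μ) := by
  simp only [Literature.MathematicalPhysics.QuantumFieldTheory.Site.shift, Finset.sum_add_distrib]
  have e1 := sum_site_translate g (Pi.single μ 1) j
  have e2 := sum_site_translate g (Pi.single j 1) μ
  have e4 : ∑ x : Literature.MathematicalPhysics.QuantumFieldTheory.Site 3 L, g (x - Pi.single j 1 + Pi.single μ 1, j) =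
      ∑ x : Literature.MathematicalPhysics.QuantumFieldTheory.Site 3 L, g (x, j) := by
    have h := sum_site_translate g (-Pi.single j 1 + Pi.single μ 1) j
    simpa only [sub_eq_add_neg, add_assoc] using h
  have e5 : ∑ x : Literature.MathematicalPhysics.QuantumFieldTheory.Site 3 L, g (x - Pi.single j 1, μ) =
      ∑ x : Literature.MathematicalPhysics.QuantumFieldTheory.Site 3 L, g (x, μ) := by
    have h := sum_site_translate g (-Pi.single j 1) μ
    simpa only [sub_eq_add_neg] using h
  have e6 : ∑ x : Literature.MathematicalPhysics.QuantumFieldTheory.Site 3 L, g (x - Pi.single j 1, j) =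
      ∑ x : Literature.MathematicalPhysics.QuantumFieldTheory.Site 3 L, g (x, j) := by
    have h := sum_site_translate g (-Pi.single j 1) j
    simpa only [sub_eq_add_neg] using h
  rw [e1, e2, e4, e5, e6]; ring

/-- Splitting the link sum into base point and direction. [folklore] -/
theorem sum_edge_plaquetteNeighbours_split (g : Edge 3 L → ℝ) :
    ∑ e : Edge 3 L, ∑ j ∈ univ.erase e.2,
        ((g (e.1.shift e.2, j) + g (e.1.shift j, e.2) + g (e.1, j)) +
          (g ((e.1 - Pi.single j 1).shift e.2, j) + g (e.1 - Pi.single j 1, e.2) + g (e.1 - Pi.single j 1, j))) =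
      ∑ x : Literature.MathematicalPhysics.QuantumFieldTheory.Site 3 L, ∑ μ : Fin 3, ∑ j ∈ univ.erase μ,
          ((g (x.shift μ, j) + g (x.shift j, μ) + g (x, j)) +
            (g ((x - Pi.single j 1).shift μ, j) + g (x - Pi.single j 1, μ) + g (x - Pi.single j 1, j))) := by
  rw [Fintype.sum_prod_type]

/-- Moving the base-point sum inside. [folklore] -/
theorem sum_site_plaquetteNeighbours_comm (g : Edge 3 L → ℝ) :
    ∑ x : Literature.MathematicalPhysics.QuantumFieldTheory.Site 3 L, ∑ μ : Fin 3, ∑ j ∈ univ.erase μ,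
          ((g (x.shift μ, j) + g (x.shift j, μ) + g (x, j)) +
            (g ((x - Pi.single j 1).shift μ, j) + g (x - Pi.single j 1, μ) + g (x - Pi.single j 1, j))) =
    ∑ μ : Fin 3, ∑ j ∈ univ.erase μ, ∑ x : Literature.MathematicalPhysics.QuantumFieldTheory.Site 3 L,
          ((g (x.shift μ, j) + g (x.shift j, μ) + g (x, j)) +
            (g ((x - Pi.single j 1).shift μ, j) + g (x - Pi.single j 1, μ) + g (x - Pi.single j 1, j))) := by
  rw [Finset.sum_comm]
  exact Finset.sum_congr rfl fun μ _ => Finset.sum_comm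

/-- The direction count: `Σ_μ Σ_{j ≠ μ} (4 S_j + 2 S_μ) = 12 Σ_ν S_ν` in three dimensions. [folklore] -/
theorem sum_directions_twelve (S : Fin 3 → ℝ) :
    ∑ μ : Fin 3, ∑ j ∈ univ.erase μ, (4 * S j + 2 * S μ) = 12 * ∑ ν : Fin 3, S ν := by
  simp only [Finset.sum_erase_eq_sub (Finset.mem_univ _), Fin.sum_univ_three]
  ring

/-- ★ **Plaquette-neighbour count on `(ℤ/L)³`**: summing a link function over the six non-root links of the two plaquettes through
`e` in each of the two planes containing `e`, and then over all links `e`, counts every link exactly `12` times: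
`Σ_e Σ_{j ≠ e.2} Σ_f g(f) = 12 Σ_f g(f)` (each of the 36 families `e ↦ f` is a translation composed with a change of direction).
[folklore] -/
theorem sum_plaquetteNeighbours_eq (g : Edge 3 L → ℝ) :
    ∑ e : Edge 3 L, ∑ j ∈ univ.erase e.2,
        ((g (e.1.shift e.2, j) + g (e.1.shift j, e.2) + g (e.1, j)) +
          (g ((e.1 - Pi.single j 1).shift e.2, j) + g (e.1 - Pi.single j 1, e.2) + g (e.1 - Pi.single j 1, j))) =
      12 * ∑ f : Edge 3 L, g f := by
  have htot : ∑ f : Edge 3 L, g f =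
      ∑ ν : Fin 3, ∑ x : Literature.MathematicalPhysics.QuantumFieldTheory.Site 3 L, g (x, ν) := by
    rw [Fintype.sum_prod_type, Finset.sum_comm]
  rw [sum_edge_plaquetteNeighbours_split, sum_site_plaquetteNeighbours_comm, htot, ← sum_directions_twelve]
  refine Finset.sum_congr rfl fun μ _ => Finset.sum_congr rfl fun j _ => ?_
  exact sum_site_plaquetteNeighbours g μ j

/-- ★★ **WEIGHTED LIPSCHITZ ESTIMATE FOR THE `SU(2)` DOSS–SUSSMANN FIELD** (`d = 3`, any `L`, any coupling `β`).  Let `w ≥ 0` be a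
weight on links with `w_e ≤ K·w_f` whenever `f` is one of the non-root links of a plaquette through `e` (`K ≥ 0`).  Then for every
unitary frame `p` and unitary-valued `M, M'`:
`Σ_e w_e ‖F(p,M)_e − F(p,M')_e‖_F ≤ |β|·(4 + 4√2 + 12K) · Σ_e w_e ‖M_e − M'_e‖_F`.
With `w ≡ 1`, `K = 1` this is a global `ℓ¹`-Frobenius Lipschitz bound with constant `|β|(16 + 4√2)`; with `w_e = K^{dist(e,e₀)}` it is
the input of the Lieb–Robinson (weighted Grönwall) argument. [folklore] -/
theorem weighted_dossSussmannField_lipschitz (β : ℝ)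
    (p M M' : Edge 3 L → Matrix (Fin (fundamentalLatticeRep 2).N) (Fin (fundamentalLatticeRep 2).N) ℂ)
    (hp : ∀ f, p f ∈ Matrix.unitaryGroup (Fin (fundamentalLatticeRep 2).N) ℂ)
    (hM : ∀ f, M f ∈ Matrix.unitaryGroup (Fin (fundamentalLatticeRep 2).N) ℂ)
    (hM' : ∀ f, M' f ∈ Matrix.unitaryGroup (Fin (fundamentalLatticeRep 2).N) ℂ)
    (w : Edge 3 L → ℝ) (hw0 : ∀ e, 0 ≤ w e) (K : ℝ)
    (hw : ∀ (e : Edge 3 L) (j : Fin 3), j ≠ e.2 →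
      w e ≤ K * w (e.1.shift e.2, j) ∧ w e ≤ K * w (e.1.shift j, e.2) ∧ w e ≤ K * w (e.1, j) ∧
      w e ≤ K * w ((e.1 - Pi.single j 1).shift e.2, j) ∧ w e ≤ K * w (e.1 - Pi.single j 1, e.2) ∧
      w e ≤ K * w (e.1 - Pi.single j 1, j)) :
    ∑ e : Edge 3 L, w e * frobNorm ((p e)ᴴ * (fundamentalLatticeRep 2).driftLie β (fun f => p f * M f) e * (p e * M e) -
        (p e)ᴴ * (fundamentalLatticeRep 2).driftLie β (fun f => p f * M' f) e * (p e * M' e)) ≤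
      |β| * (4 + 4 * Real.sqrt 2 + 12 * K) * ∑ e : Edge 3 L, w e * frobNorm (M e - M' e) := by
  set δ : Edge 3 L → ℝ := fun f => frobNorm (M f - M' f) with hδ
  set six : Edge 3 L → Fin 3 → ℝ := fun e j =>
    (δ (e.1.shift e.2, j) + δ (e.1.shift j, e.2) + δ (e.1, j)) +
      (δ ((e.1 - Pi.single j 1).shift e.2, j) + δ (e.1 - Pi.single j 1, e.2) + δ (e.1 - Pi.single j 1, j)) with hsix
  set wsix : Edge 3 L → Fin 3 → ℝ := fun e j =>
    ((w (e.1.shift e.2, j) * δ (e.1.shift e.2, j)) + (w (e.1.shift j, e.2) * δ (e.1.shift j, e.2)) + (w (e.1, j) * δ (e.1, j))) +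
      ((w ((e.1 - Pi.single j 1).shift e.2, j) * δ ((e.1 - Pi.single j 1).shift e.2, j)) +
        (w (e.1 - Pi.single j 1, e.2) * δ (e.1 - Pi.single j 1, e.2)) + (w (e.1 - Pi.single j 1, j) * δ (e.1 - Pi.single j 1, j)))
    with hwsix
  have hδ0 : ∀ f, 0 ≤ δ f := fun f => frobNorm_nonneg _
  have hcard : ∀ e : Edge 3 L, ((univ.erase e.2).card : ℝ) = 2 := fun e => by
    rw [Finset.card_erase_of_mem (Finset.mem_univ _), Finset.card_univ, Fintype.card_fin]
    show ((3 - 1 : ℕ) : ℝ) = 2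
    norm_num
  have hN : Real.sqrt ((fundamentalLatticeRep 2).N : ℝ) = Real.sqrt 2 := by
    have : ((fundamentalLatticeRep 2).N : ℝ) = 2 := by show ((2 : ℕ) : ℝ) = 2; norm_num
    rw [this]
  -- per-link locality, with the card and `√N` evaluated
  have hloc : ∀ e : Edge 3 L, w e * frobNorm ((p e)ᴴ * (fundamentalLatticeRep 2).driftLie β (fun f => p f * M f) e * (p e * M e) -
      (p e)ᴴ * (fundamentalLatticeRep 2).driftLie β (fun f => p f * M' f) e * (p e * M' e)) ≤
      w e * (|β| * (2 * (2 * Real.sqrt 2)) * δ e + |β| * ∑ j ∈ univ.erase e.2, (2 * δ e + six e j)) := by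
    intro e
    have h := frobNorm_dossSussmannField_sub_le_local (fundamentalLatticeRep 2) β p M M' hp hM hM' e
    rw [hcard e, hN] at h
    refine mul_le_mul_of_nonneg_left ?_ (hw0 e)
    simpa only [hδ, hsix, add_assoc] using h
  -- the weight moves onto the neighbours
  have hmove : ∀ e : Edge 3 L, ∀ j ∈ univ.erase e.2, w e * six e j ≤ K * wsix e j := by
    intro e j hj
    obtain ⟨h1, h2, h3, h4, h5, h6⟩ := hw e j (Finset.ne_of_mem_erase hj)
    have i1 := mul_le_mul_of_nonneg_right h1 (hδ0 (e.1.shift e.2, j))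
    have i2 := mul_le_mul_of_nonneg_right h2 (hδ0 (e.1.shift j, e.2))
    have i3 := mul_le_mul_of_nonneg_right h3 (hδ0 (e.1, j))
    have i4 := mul_le_mul_of_nonneg_right h4 (hδ0 ((e.1 - Pi.single j 1).shift e.2, j))
    have i5 := mul_le_mul_of_nonneg_right h5 (hδ0 (e.1 - Pi.single j 1, e.2))
    have i6 := mul_le_mul_of_nonneg_right h6 (hδ0 (e.1 - Pi.single j 1, j))
    simp only [hsix, hwsix]
    nlinarith
  -- per-link bound in final form
  have hper : ∀ e : Edge 3 L, w e * frobNorm ((p e)ᴴ * (fundamentalLatticeRep 2).driftLie β (fun f => p f * M f) e * (p e * M e) -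
      (p e)ᴴ * (fundamentalLatticeRep 2).driftLie β (fun f => p f * M' f) e * (p e * M' e)) ≤
      |β| * (4 * Real.sqrt 2 + 4) * (w e * δ e) + |β| * K * ∑ j ∈ univ.erase e.2, wsix e j := by
    intro e
    refine (hloc e).trans ?_
    have hsplit : ∑ j ∈ univ.erase e.2, (2 * δ e + six e j) = 2 * (2 * δ e) + ∑ j ∈ univ.erase e.2, six e j := by
      rw [Finset.sum_add_distrib, Finset.sum_const, nsmul_eq_mul, hcard e]
    have hK' : w e * ∑ j ∈ univ.erase e.2, six e j ≤ K * ∑ j ∈ univ.erase e.2, wsix e j := by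
      rw [Finset.mul_sum, Finset.mul_sum]
      exact Finset.sum_le_sum fun j hj => hmove e j hj
    rw [hsplit]
    have hβ := abs_nonneg β
    have hK'' := mul_le_mul_of_nonneg_left hK' hβ
    nlinarith [hw0 e, hδ0 e]
  -- sum over the links and count
  have hcount : ∑ e : Edge 3 L, ∑ j ∈ univ.erase e.2, wsix e j = 12 * ∑ f : Edge 3 L, w f * δ f :=
    sum_plaquetteNeighbours_eq (fun f => w f * δ f)
  calc ∑ e : Edge 3 L, w e * frobNorm ((p e)ᴴ * (fundamentalLatticeRep 2).driftLie β (fun f => p f * M f) e * (p e * M e) -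
          (p e)ᴴ * (fundamentalLatticeRep 2).driftLie β (fun f => p f * M' f) e * (p e * M' e))
      ≤ ∑ e : Edge 3 L, (|β| * (4 * Real.sqrt 2 + 4) * (w e * δ e) + |β| * K * ∑ j ∈ univ.erase e.2, wsix e j) :=
        Finset.sum_le_sum fun e _ => hper e
    _ = |β| * (4 * Real.sqrt 2 + 4) * ∑ e : Edge 3 L, w e * δ e + |β| * K * (12 * ∑ f : Edge 3 L, w f * δ f) := by
        rw [Finset.sum_add_distrib, ← Finset.mul_sum, ← Finset.mul_sum, hcount]
    _ = |β| * (4 + 4 * Real.sqrt 2 + 12 * K) * ∑ e : Edge 3 L, w e * frobNorm (M e - M' e) := by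
        simp only [hδ]; ring

end Torus

end Summit.QuantumFields.YangMills.Theorems.ColdStartUniversality.LiebRobinson
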